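import Summits.KontsevichZagierPeriods.KontsevichZagierPeriods.Theses.ComplexOrientations
import Summits.KontsevichZagierPeriods.KontsevichZagierPeriods.Theorems.ComplexOrientationsOvalSectorDiscSector
import Summits.KontsevichZagierPeriods.KontsevichZagierPeriods.Theorems.ComplexOrientationsOvalSectorCircleInterior
import Summits.KontsevichZagierPeriods.KontsevichZagierPeriods.Theorems.ComplexOrientationsOvalSectorTranslateDisc
import Summits.KontsevichZagierPeriods.KontsevichZagierPeriods.Theorems.ComplexOrientationsComplexOrientationIdentityEllipse
import Literature.NumberTheory.Transcendental.KZLogCalculusProofs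
import Literature.NumberTheory.Transcendental.KZSemialgebraicComplex
import Literature.NumberTheory.Transcendental.SemialgebraicMapsProofs

/-!
# `OvalSector` (crux stmt-KontsevichZagierPeriods-11369), line `birth` — the CONIC SECTOR

Route `KontsevichZagierPeriods/ComplexOrientations`, crux `OvalSector` (Kontsevich–Zagier's
Conjecture 1 on the integer oval sector of one compact real-smooth plane curve). This file closes,
unconditionally, the sub-sector in which every oval is an ELLIPSE with real-algebraic data:

* `affine_sub_mem_changeOfVariablesRel` — rule (2) of the calculus along an affine map
  `u ↦ M u + c` of the plane with real-algebraic matrix `M` (`det M ≠ 0`) and centre `c`;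
* `of_ellipseInterior_sub_of_constMul_mem_relations` — for a positive definite binary form
  `Q = A x₀² + B x₀x₁ + C x₁²` (`A > 0`, `D = 4AC − B² > 0`), `ρ > 0`, all real-algebraic, the
  integrand-1 representation over the inside `{Q(· − c) < ρ}` of the ellipse and the unit disc with
  the CONSTANT integrand `2ρ/√D` differ by ONE move (the affine chart
  `M = √ρ·[[1/√A, −B/(√A√D)], [0, 2√A/√D]]`, `Q(Mv) = ρ|v|²`, `det M = 2ρ/√D`);
* `stub_conicSector` (registered stub of `Lines/birth.lean`) — hence, if every oval `Oᵢ` is such an ellipse, EVERY true integer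
  identity `Σ nᵢ·Area(Rᵢ) = Area(disc β)` among the interiors is a chain of moves (interiors =
  insides by `ovalInterior_ellipse`; values by soundness; `Σ nᵢ[D, aᵢ] − [D, β]` is rule-1b
  bookkeeping, `sum_zsmul_of_sub_of_mem_relations`);
* `circleSector_sub_mem_relations` — the same for circles `{(u₀ − a)² + (u₁ − b)² = c}` given by
  centre and radius² (the circle branch of the composition `OvalSector_of`, packaged: interiors by
  `stub_circleInterior`, translations by `stub_translateDisc`, then `stub_discSector`).

References: M. Kontsevich, D. Zagier, *Periods* (2001), §1.2 rules (1), (2);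
J. Bochnak, M. Coste, M.-F. Roy, *Real Algebraic Geometry* (1998), §2.2.
-/

noncomputable section

open Set MeasureTheory MvPolynomial
open Literature.NumberTheory.Transcendental Literature.ModelTheory.ExponentialFields
open Literature.AlgebraicGeometry.RealAlgebraic (ovalInterior mem_ovalInterior_iff)
open Summit.KontsevichZagierPeriods.KontsevichZagierPeriods.Theses.ComplexOrientations

namespace Summit.KontsevichZagierPeriods.ComplexOrientations.OvalSector

/-! ### Rule (2) along an affine map of the plane -/

/-- An affine map `u ↦ M u + c` of the plane with real-algebraic matrix entries and centre is a
`ℚ`-semialgebraic map on every `ℚ`-semialgebraic set. [cite: BochnakCosteRoy1998, §2.2] -/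
theorem isSemialgebraicMapOn_affine {σ : Set (Fin 2 → ℝ)} (hσ : IsSemialgebraic ℚ σ)
    (M : Matrix (Fin 2) (Fin 2) ℝ) (c : Fin 2 → ℝ) (hM : ∀ i j, IsAlgebraic ℚ (M i j))
    (hc : ∀ i, IsAlgebraic ℚ (c i)) :
    IsSemialgebraicMapOn ℚ σ (fun u : Fin 2 → ℝ => Matrix.mulVec M u + c) := by
  refine IsSemialgebraicMapOn.of_forall hσ fun i => ?_
  have hx : ∀ j : Fin 2, IsSemialgebraicFunOn ℚ σ (fun u : Fin 2 → ℝ => u j) := fun j =>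
    (isSemialgebraicFunOn_aeval hσ (X j : MvPolynomial (Fin 2) ℚ)).congr fun u _ => by simp
  have h := IsSemialgebraicFunOn.add_holds (IsSemialgebraicFunOn.add_holds
    (IsSemialgebraicFunOn.mul_holds (isSemialgebraicFunOn_const_of_isAlgebraic hσ (hM i 0)) (hx 0))
    (IsSemialgebraicFunOn.mul_holds (isSemialgebraicFunOn_const_of_isAlgebraic hσ (hM i 1)) (hx 1)))
    (isSemialgebraicFunOn_const_of_isAlgebraic hσ (hc i))
  refine h.congr fun u _ => ?_
  simp only [Pi.add_apply, Pi.mul_apply]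
  change _ = (∑ j, M i j * u j) + c i
  rw [Fin.sum_univ_two]

/-- **Rule (2) along an affine map of the plane.** For a real-algebraic matrix `M` with
`det M ≠ 0`, a real-algebraic centre `c`, and representations `r`, `r'` of dimension `2` with
`r'.domain = (M · + c) '' r.domain` and `r.integrand x = r'.integrand (M x + c) · |det M|` on
`r.domain`: `[r] − [r'] ∈ KZ.changeOfVariablesRel` (witness `Φ = (M · + c)`, `Φ' = M`).
[cite: KontsevichZagier2001, §1.2 rule (2)] -/
theorem affine_sub_mem_changeOfVariablesRel (M : Matrix (Fin 2) (Fin 2) ℝ) (c : Fin 2 → ℝ)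
    (hM : ∀ i j, IsAlgebraic ℚ (M i j)) (hc : ∀ i, IsAlgebraic ℚ (c i)) (hdet : M.det ≠ 0)
    (r r' : KZ.IntegralRep 2)
    (hdom : r'.domain = (fun u : Fin 2 → ℝ => Matrix.mulVec M u + c) '' r.domain)
    (hint : ∀ x ∈ r.domain, r.integrand x = r'.integrand (Matrix.mulVec M x + c) * |M.det|) :
    KZ.of r - KZ.of r' ∈ KZ.changeOfVariablesRel := by
  set L : (Fin 2 → ℝ) →L[ℝ] (Fin 2 → ℝ) := LinearMap.toContinuousLinearMap (Matrix.toLin' M)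
    with hL
  have hLapp : ∀ u, L u = Matrix.mulVec M u := fun u => by
    rw [hL, LinearMap.coe_toContinuousLinearMap', Matrix.toLin'_apply]
  have hLdet : L.det = M.det := by
    rw [ContinuousLinearMap.det, hL, LinearMap.coe_toContinuousLinearMap, LinearMap.det_toLin']
  have hinj : Function.Injective (Matrix.mulVec M) :=
    Matrix.mulVec_injective_iff_isUnit.mpr
      ((Matrix.isUnit_iff_isUnit_det M).mpr (isUnit_iff_ne_zero.mpr hdet))
  refine ⟨2, r, r', fun u => Matrix.mulVec M u + c, fun _ => L,
    isSemialgebraicMapOn_affine r.isSemialgebraic_domain M c hM hc, fun u _ => ?_,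
    fun u _ v _ h => hinj (add_right_cancel h), hdom, fun x hx => by rw [hint x hx, hLdet], rfl⟩
  have h : HasFDerivAt (fun u => L u + c) L u := L.hasFDerivAt.add_const c
  simp only [hLapp] at h
  exact h.hasFDerivWithinAt

/-! ### The inside of an ellipse is the unit disc with a constant integrand -/

/-- **The ellipse chart.** For a positive definite binary form `Q = A x₀² + B x₀x₁ + C x₁²`
(`A > 0`, `D = 4AC − B² > 0`), `ρ > 0`, all real-algebraic, a real-algebraic centre `c`, an
integrand-1 representation `s` over the inside `{Q(· − c) < ρ}` and an integrand-1 representation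
`Dsc` over the centred unit disc: `[s] − [Dsc, 2ρ/√D] ∈ KZ.relations` — one rule-2 move along
`v ↦ M v + c`, `M = √ρ·[[1/√A, −B/(√A√D)], [0, 2√A/√D]]` (`Q(Mv) = ρ(v₀² + v₁²)`,
`det M = 2ρ/√D`). [cite: KontsevichZagier2001, §1.2 rule (2)] -/
theorem of_ellipseInterior_sub_of_constMul_mem_relations {A B C ρ : ℝ} (hA : 0 < A)
    (hD : 0 < 4 * A * C - B ^ 2) (hρ : 0 < ρ) (hAa : IsAlgebraic ℚ A) (hBa : IsAlgebraic ℚ B)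
    (hCa : IsAlgebraic ℚ C) (hρa : IsAlgebraic ℚ ρ) (c : Fin 2 → ℝ) (hc : ∀ i, IsAlgebraic ℚ (c i))
    (s Dsc : KZ.IntegralRep 2)
    (hs : s.domain = {u : Fin 2 → ℝ |
      A * (u - c) 0 ^ 2 + B * ((u - c) 0 * (u - c) 1) + C * (u - c) 1 ^ 2 < ρ})
    (hs1 : ∀ v ∈ s.domain, s.integrand v = 1)
    (hDsc : Dsc.domain = {v : Fin 2 → ℝ | v 0 ^ 2 + v 1 ^ 2 < 1})
    (hDsc1 : ∀ v ∈ Dsc.domain, Dsc.integrand v = 1)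
    (ha : IsAlgebraic ℚ (2 * ρ / √(4 * A * C - B ^ 2))) :
    KZ.of s - KZ.of (Dsc.constMul (2 * ρ / √(4 * A * C - B ^ 2)) ha) ∈ KZ.relations := by
  -- the square roots
  set sA := √A with hsA
  set sD := √(4 * A * C - B ^ 2) with hsD
  set sρ := √ρ with hsρ
  have hsA0 : 0 < sA := Real.sqrt_pos.2 hA
  have hsD0 : 0 < sD := Real.sqrt_pos.2 hD
  have hsρ0 : 0 < sρ := Real.sqrt_pos.2 hρ
  have hsA2 : sA ^ 2 = A := Real.sq_sqrt hA.le
  have hsD2 : sD ^ 2 = 4 * A * C - B ^ 2 := Real.sq_sqrt hD.le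
  have hsρ2 : sρ ^ 2 = ρ := Real.sq_sqrt hρ.le
  have hsAa : IsAlgebraic ℚ sA := IsAlgebraic.of_pow two_pos (by rw [hsA2]; exact hAa)
  have hsDa : IsAlgebraic ℚ sD := IsAlgebraic.of_pow two_pos (by
    rw [hsD2]
    exact (((isAlgebraic_nat 4).mul hAa).mul hCa).sub (hBa.pow 2))
  have hsρa : IsAlgebraic ℚ sρ := IsAlgebraic.of_pow two_pos (by rw [hsρ2]; exact hρa)
  -- the chart matrix
  set M : Matrix (Fin 2) (Fin 2) ℝ :=
    !![sρ * sA⁻¹, -(sρ * B * (sA⁻¹ * sD⁻¹)); 0, 2 * sρ * sA * sD⁻¹] with hM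
  have hMa : ∀ i j, IsAlgebraic ℚ (M i j) := by
    intro i j
    fin_cases i <;> fin_cases j
    · exact hsρa.mul hsAa.inv
    · exact ((hsρa.mul hBa).mul (hsAa.inv.mul hsDa.inv)).neg
    · exact isAlgebraic_zero
    · exact (((isAlgebraic_nat 2).mul hsρa).mul hsAa).mul hsDa.inv
  have hM0 : ∀ v : Fin 2 → ℝ, Matrix.mulVec M v 0 = sρ * sA⁻¹ * v 0 - sρ * B * (sA⁻¹ * sD⁻¹) * v 1 :=
    fun v => by simp [hM, Matrix.mulVec, dotProduct, Fin.sum_univ_two]; ring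
  have hM1 : ∀ v : Fin 2 → ℝ, Matrix.mulVec M v 1 = 2 * sρ * sA * sD⁻¹ * v 1 :=
    fun v => by simp [hM, Matrix.mulVec, dotProduct, Fin.sum_univ_two]
  have hdet : M.det = 2 * ρ / sD := by
    rw [hM, Matrix.det_fin_two_of, ← hsρ2]
    field_simp
    ring
  have hdet0 : M.det ≠ 0 := by
    rw [hdet]
    positivity
  -- `Q(Mv) = ρ |v|²`
  have hQM : ∀ v : Fin 2 → ℝ, A * (Matrix.mulVec M v 0) ^ 2 +
      B * (Matrix.mulVec M v 0 * Matrix.mulVec M v 1) + C * (Matrix.mulVec M v 1) ^ 2 =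
      ρ * (v 0 ^ 2 + v 1 ^ 2) := by
    intro v
    have hC : C = (sD ^ 2 + B ^ 2) / (4 * sA ^ 2) := by
      rw [hsD2, hsA2]
      field_simp
      ring
    rw [hM0, hM1, hC, ← hsA2, ← hsρ2]
    field_simp
    ring
  -- the image of the unit disc is the inside of the ellipse
  have hdom : s.domain = (fun u : Fin 2 → ℝ => Matrix.mulVec M u + c) ''
      (Dsc.constMul (2 * ρ / √(4 * A * C - B ^ 2)) ha).domain := by
    rw [KZ.IntegralRep.domain_constMul, hDsc, hs]
    ext u
    simp only [mem_setOf_eq, mem_image]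
    constructor
    · intro hu
      have hsurj : Function.Surjective (Matrix.mulVec M) :=
        Matrix.mulVec_surjective_iff_isUnit.mpr
          ((Matrix.isUnit_iff_isUnit_det M).mpr (isUnit_iff_ne_zero.mpr hdet0))
      obtain ⟨v, hv⟩ := hsurj (u - c)
      refine ⟨v, ?_, by rw [hv, sub_add_cancel]⟩
      have h := hQM v
      rw [hv] at h
      rw [h] at hu
      nlinarith
    · rintro ⟨v, hv, rfl⟩
      simp only [add_sub_cancel_right]
      rw [hQM v]
      calc ρ * (v 0 ^ 2 + v 1 ^ 2) < ρ * 1 := mul_lt_mul_of_pos_left hv hρ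
        _ = ρ := mul_one ρ
  have h := KZ.changeOfVariablesRel_subset_relations
    (affine_sub_mem_changeOfVariablesRel M c hMa hc hdet0
      (Dsc.constMul (2 * ρ / √(4 * A * C - B ^ 2)) ha) s hdom fun x hx => by
        have hx' : Matrix.mulVec M x + c ∈ s.domain := by
          rw [hdom]
          exact mem_image_of_mem _ hx
        rw [KZ.IntegralRep.domain_constMul] at hx
        rw [KZ.IntegralRep.integrand_constMul, hs1 _ hx']
        dsimp only
        rw [hDsc1 x hx, hdet, abs_of_pos (by positivity)]
        ring)
  simpa using KZ.relations.neg_mem h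

/-! ### The conic sector -/

/-- **Stub `stub_conicSector`: the conic sector is a chain.** Let the ovals `O i` (`i < k`) be ellipses
`{u | Aᵢ(u − cᵢ)₀² + Bᵢ(u − cᵢ)₀(u − cᵢ)₁ + Cᵢ(u − cᵢ)₁² = ρᵢ}` with real-algebraic data,
`Aᵢ > 0`, `4AᵢCᵢ − Bᵢ² > 0`, `ρᵢ > 0`; `s i` integrand-1 representations over their interiors
`{v ∉ O i ∧ the connected component of v in (O i)ᶜ is bounded}`; `e` an integrand-1 representation
over the centred disc of real-algebraic radius² `β ≥ 0`; `n` ANY integer vector with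
`Σ nᵢ·value(s i) = value(e)`. Then `Σ nᵢ[s i] − [e] ∈ KZ.relations`: interiors are the insides
(`ovalInterior_ellipse`), each inside is the unit disc `D` with constant integrand
`aᵢ = 2ρᵢ/√Dᵢ` (`of_ellipseInterior_sub_of_constMul_mem_relations`), `[e] ~ [D, β]`
(`of_disc_sub_of_constMul_mem_relations`), soundness and `Area(D) ≠ 0` give `Σ nᵢaᵢ = β`, and
`Σ nᵢ[D, aᵢ] − [D, β]` is rule 1b (`sum_zsmul_of_sub_of_mem_relations`). No hypothesis on the curve
is needed, and no area is computed. [cite: KontsevichZagier2001, §1.2 rules (1), (2)] -/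
theorem stub_conicSector (k : ℕ) (O : Fin k → Set (Fin 2 → ℝ))
    (s : Fin k → KZ.IntegralRep 2) (A B C ρ : Fin k → ℝ) (c : Fin k → Fin 2 → ℝ)
    (hA : ∀ i, 0 < A i) (hD : ∀ i, 0 < 4 * A i * C i - B i ^ 2) (hρ : ∀ i, 0 < ρ i)
    (hAa : ∀ i, IsAlgebraic ℚ (A i)) (hBa : ∀ i, IsAlgebraic ℚ (B i))
    (hCa : ∀ i, IsAlgebraic ℚ (C i)) (hρa : ∀ i, IsAlgebraic ℚ (ρ i))
    (hc : ∀ i j, IsAlgebraic ℚ (c i j))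
    (hOe : ∀ i, O i = {u : Fin 2 → ℝ |
      A i * (u - c i) 0 ^ 2 + B i * ((u - c i) 0 * (u - c i) 1) + C i * (u - c i) 1 ^ 2 = ρ i})
    (hsdom : ∀ i, (s i).domain =
      {v : Fin 2 → ℝ | v ∉ O i ∧ Bornology.IsBounded (connectedComponentIn (O i)ᶜ v)})
    (hsint : ∀ i, ∀ v ∈ (s i).domain, (s i).integrand v = 1)
    (n : Fin k → ℤ) (β : ℝ) (e : KZ.IntegralRep 2) (hβ : IsAlgebraic ℚ β) (hβ0 : 0 ≤ β)
    (hedom : e.domain = {v : Fin 2 → ℝ | v 0 ^ 2 + v 1 ^ 2 < β})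
    (heint : ∀ v ∈ e.domain, e.integrand v = 1)
    (hval : ∑ i, (n i : ℝ) * (s i).value = e.value) :
    (∑ i, n i • KZ.of (s i)) - KZ.of e ∈ KZ.relations := by
  obtain ⟨Dsc, hDsc, hDsc1, hDsc0⟩ := exists_unitDiscRep
  -- the interiors are the insides of the ellipses
  have hsd : ∀ i, (s i).domain = {u : Fin 2 → ℝ |
      A i * (u - c i) 0 ^ 2 + B i * ((u - c i) 0 * (u - c i) 1) + C i * (u - c i) 1 ^ 2 < ρ i} := by
    intro i
    have h := ovalInterior_ellipse (Q := fun x => A i * x 0 ^ 2 + B i * (x 0 * x 1) + C i * x 1 ^ 2)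
      (fun _ => rfl) (hA i) (hD i) (c i) (hρ i)
    rw [hsdom i, hOe i]
    exact h
  -- the constants `aᵢ = 2ρᵢ/√Dᵢ`
  set a : Fin k → ℝ := fun i => 2 * ρ i / √(4 * A i * C i - B i ^ 2) with ha_def
  have haa : ∀ i, IsAlgebraic ℚ (a i) := fun i => by
    have hsDa : IsAlgebraic ℚ (√(4 * A i * C i - B i ^ 2)) := IsAlgebraic.of_pow two_pos (by
      rw [Real.sq_sqrt (hD i).le]
      exact (((isAlgebraic_nat 4).mul (hAa i)).mul (hCa i)).sub ((hBa i).pow 2))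
    simpa [ha_def, div_eq_mul_inv] using ((isAlgebraic_nat 2).mul (hρa i)).mul hsDa.inv
  -- each interior against the scaled unit disc, and the disc `e`
  have hr : ∀ i, KZ.of (s i) - KZ.of (Dsc.constMul (a i) (haa i)) ∈ KZ.relations := fun i =>
    of_ellipseInterior_sub_of_constMul_mem_relations (hA i) (hD i) (hρ i) (hAa i) (hBa i) (hCa i)
      (hρa i) (c i) (hc i) (s i) Dsc (hsd i) (hsint i) hDsc hDsc1 (haa i)
  have he : KZ.of e - KZ.of (Dsc.constMul β hβ) ∈ KZ.relations :=
    of_disc_sub_of_constMul_mem_relations β hβ hβ0 e Dsc hedom heint hDsc hDsc1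
  -- values, by soundness of the calculus
  have hvs : ∀ i, (s i).value = a i * Dsc.value := fun i => by
    rw [KZ.Equivalent.value_eq_holds (hr i), KZ.IntegralRep.value_constMul]
  have hve : e.value = β * Dsc.value := by
    rw [KZ.Equivalent.value_eq_holds he, KZ.IntegralRep.value_constMul]
  have hsum : ∑ i, (n i : ℝ) * a i = β := by
    have h : (∑ i, (n i : ℝ) * a i) * Dsc.value = β * Dsc.value := by
      rw [← hve, ← hval, Finset.sum_mul]
      exact Finset.sum_congr rfl fun i _ => by rw [hvs i, mul_assoc]
    exact mul_right_cancel₀ hDsc0 h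
  -- bookkeeping on the unit disc
  have hB : (∑ i, n i • KZ.of (Dsc.constMul (a i) (haa i))) - KZ.of (Dsc.constMul β hβ) ∈
      KZ.relations :=
    sum_zsmul_of_sub_of_mem_relations Finset.univ Dsc (fun i => Dsc.constMul (a i) (haa i)) a n
      (fun i _ => rfl) (fun i _ x _ => rfl) (fun i _ => haa i) (Dsc.constMul β hβ) rfl
      (fun x _ => by rw [hsum, KZ.IntegralRep.integrand_constMul])
  -- assemble
  have hsplit : (∑ i, n i • KZ.of (s i)) - KZ.of e =
      (∑ i, n i • (KZ.of (s i) - KZ.of (Dsc.constMul (a i) (haa i)))) +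
        ((∑ i, n i • KZ.of (Dsc.constMul (a i) (haa i))) - KZ.of (Dsc.constMul β hβ)) -
        (KZ.of e - KZ.of (Dsc.constMul β hβ)) := by
    simp only [smul_sub, Finset.sum_sub_distrib]
    abel
  rw [hsplit]
  exact KZ.relations.sub_mem (KZ.relations.add_mem
    (KZ.relations.sum_mem fun i _ => KZ.relations.zsmul_mem (hr i) _) hB) he

/-! ### The circle sector (unconditional) -/

/-- **The circle sector is a chain.** Let `O i` (`i < k`) be circles
`{(u₀ − aᵢ)² + (u₁ − bᵢ)² = cᵢ}` with real-algebraic `aᵢ, bᵢ, cᵢ` and `cᵢ > 0`, `s i` integrand-1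
representations over their interiors `{v ∉ O i ∧ the connected component of v in (O i)ᶜ is bounded}`,
`e` an integrand-1 representation over the centred disc of real-algebraic radius² `β ≥ 0`, and `n`
ANY integer vector with `Σ nᵢ·value(s i) = value(e)`. Then `Σ nᵢ[s i] − [e] ∈ KZ.relations`.
Chain: `stub_circleInterior` (interior = open disc), `stub_translateDisc` (one translation move per
disc), soundness (values agree along moves), `stub_discSector`.
[cite: KontsevichZagier2001, §1.2 rules (1), (2)] -/
theorem circleSector_sub_mem_relations (k : ℕ) (O : Fin k → Set (Fin 2 → ℝ))
    (s : Fin k → KZ.IntegralRep 2) (a b c : Fin k → ℝ)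
    (ha : ∀ i, IsAlgebraic ℚ (a i)) (hb : ∀ i, IsAlgebraic ℚ (b i)) (hc : ∀ i, IsAlgebraic ℚ (c i))
    (hc0 : ∀ i, 0 < c i)
    (hOc : ∀ i, O i = {u : Fin 2 → ℝ | (u 0 - a i) ^ 2 + (u 1 - b i) ^ 2 = c i})
    (hsdom : ∀ i, (s i).domain =
      {v : Fin 2 → ℝ | v ∉ O i ∧ Bornology.IsBounded (connectedComponentIn (O i)ᶜ v)})
    (hsint : ∀ i, ∀ v ∈ (s i).domain, (s i).integrand v = 1)
    (n : Fin k → ℤ) (β : ℝ) (e : KZ.IntegralRep 2) (hβ : IsAlgebraic ℚ β) (hβ0 : 0 ≤ β)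
    (hedom : e.domain = {v : Fin 2 → ℝ | v 0 ^ 2 + v 1 ^ 2 < β})
    (heint : ∀ v ∈ e.domain, e.integrand v = 1)
    (hval : ∑ i, (n i : ℝ) * (s i).value = e.value) :
    (∑ i, n i • KZ.of (s i)) - KZ.of e ∈ KZ.relations := by
  -- the interiors are the open discs, translated to the origin
  have hsd : ∀ i, (s i).domain = {v : Fin 2 → ℝ | (v 0 - a i) ^ 2 + (v 1 - b i) ^ 2 < c i} := by
    intro i
    rw [hsdom i, hOc i, stub_circleInterior (a i) (b i) (c i) (hc0 i)]
  choose d hdd hd1 hrel using fun i =>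
    stub_translateDisc (a i) (b i) (c i) (ha i) (hb i) (hc i) (s i) (hsd i) (hsint i)
  -- values agree along the translation moves (soundness)
  have hvals : ∀ i, (s i).value = (d i).value := fun i => KZ.Equivalent.value_eq_holds (hrel i)
  have hval' : ∑ i, (n i : ℝ) * (d i).value = e.value := by
    rw [← hval]
    exact Finset.sum_congr rfl fun i _ => by rw [hvals i]
  -- the centred disc sector is a chain
  have hD : (∑ i, n i • KZ.of (d i)) - KZ.of e ∈ KZ.relations :=
    stub_discSector k c hc (fun i => (hc0 i).le) d hdd hd1 n β e hβ hβ0 hedom heint hval'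
  have hsplit : (∑ i, n i • KZ.of (s i)) - KZ.of e =
      (∑ i, n i • (KZ.of (s i) - KZ.of (d i))) + ((∑ i, n i • KZ.of (d i)) - KZ.of e) := by
    simp only [smul_sub, Finset.sum_sub_distrib]
    abel
  rw [hsplit]
  exact KZ.relations.add_mem
    (KZ.relations.sum_mem fun i _ => KZ.relations.zsmul_mem (hrel i) _) hD

end Summit.KontsevichZagierPeriods.ComplexOrientations.OvalSector

end
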